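import Literature.Barriers.SmoothPoincare4.StableInvariantsBlindThetaFour
import Literature.Topology.FourManifolds.ThetaFourWall
import Literature.Topology.FourManifolds.ThetaFourKervaireMilnorProofs
import HarnessLib

/-!
# `StableBarrierFour` over the current frontier of named facts (proofs only)

Topic `Literature/Barriers/SmoothPoincare4`; fourth pure-proof companion of
`StableInvariantsBlind.lean` (after `StableInvariantsBlindProofs.lean`,
`StableInvariantsBlindParity.lean` and `StableInvariantsBlindThetaFour.lean`), written by the fact
seat of `Literature.Barriers.SmoothPoincare4.StableBarrierFour` (no invariant of the
`S² × S²`-stable diffeomorphism type distinguishes a homotopy 4-sphere from `S⁴`; D. Reutter,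
C. Schommer-Pries, *Semisimple field theories detect stable diffeomorphism*, arXiv:2206.10031,
Thm. A with §1.1, and D. Reutter, J. Topol. 16 (2023), Thm. 1 / Cor. 2). Everything here is
**proved**; no definition, no named fact and no statement of the tree is added or changed
(D-0026, net debt `0`).

Since `stableBarrierFour_of_thetaFour` (`StableInvariantsBlindThetaFour.lean`) the Wall side of
the barrier — Wall 1964, Thm. 3 for the even simply connected ends that occur — is a theorem of the
tree, and `StableBarrierFour_holds` depends on the single named fact `Θ₄ = 0`
(`Literature.Topology.FourManifolds.isHCobordant_sphere_of_homotopySphere_four`, Kervaire–Milnor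
1963, table p. 504). The earlier frontier records of `StableInvariantsBlindProofs.lean`
(`stableBarrierFour_of_wallThmTwo_thmThree`, `stableBarrierFour_of_collapseLeaves₅`, Appendix 3)
still list Wall's Thm. 3 (`exists_isStabilization_of_isHCobordant`) resp. Kirby's middle-level
statement K1′ (`exists_middleLevel_isStabilization_of_isHCobordism`) among their hypotheses. This
file records the barrier over each of the two CURRENT routes to `Θ₄ = 0` in the tree, with those
hypotheses gone, so that the exact residual proof obligation of the barrier is visible in one
place:

* `stableBarrierFour_of_forall_boundsContractible` — the barrier GIVEN only the bounding form of
  `Θ₄ = 0` (every homotopy `4`-sphere bounds a contractible compact smooth `5`-manifold; a plain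
  binder, the conclusion of `HomotopySphere.boundsContractible_four_of`), Kervaire–Milnor's
  Lemma 2.3 `⇐` being the tree theorem `isHCobordant_sphere_of_boundsContractible_holds`;
* `stableBarrierFour_of_wallThmTwo` — **the barrier from Wall 1964, Thm. 2 ALONE**
  (`isHCobordant_of_equivalent_intersectionForm`; through
  `isHCobordant_sphere_of_homotopySphere_four_of_wallThmTwo`, `ThetaFourWall.lean`).
  REMAINING HYPOTHESES: 1;
* `stableBarrierFour_of_kervaireMilnorFrontier` — **the barrier over the four remaining leaves of
  Kervaire–Milnor's proof of `Θ₄ = 0`**: Thm. 3.1 in dimension `4` only (every homotopy `4`-sphere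
  is s-parallelizable), Lemma 4.2 `⇒` (`boundsParallelizable_of_collapseNullHomotopic`), `Π₄ = 0`
  (`piStable_four_trivial`) and Thm. 5.1 at `k = 2`
  (`HomotopySphere.boundsContractible_of_nullCobordism_isStablyParallelizable_four`), through
  `isHCobordant_sphere_of_homotopySphere_four_of_frontier₄` (`ThetaFourKervaireMilnorProofs.lean`).
  REMAINING HYPOTHESES: 4.

The eventual discharge `StableBarrierFour_holds` is `stableBarrierFour_of_thetaFour` applied to
`isHCobordant_sphere_of_homotopySphere_four_holds`, or one of the theorems below applied to the
`_holds` of its hypotheses, whichever lands first.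

## References

* D. Reutter, C. Schommer-Pries, *Semisimple field theories detect stable diffeomorphism*,
  arXiv:2206.10031 (2022), Thm. A and §1.1. [ReutterSchommerPries2022]
* D. Reutter, *Semisimple 4-dimensional topological field theories cannot detect exotic smooth
  structure*, J. Topol. 16 (2023), Thm. 1, Cor. 2. [Reutter2023SemisimpleTFT]
* C. T. C. Wall, *On simply-connected 4-manifolds*, J. London Math. Soc. 39 (1964) 141–149,
  Thm. 2 (p. 141), Thm. 3. [WallJLMS1964]
* M. Kervaire, J. Milnor, *Groups of homotopy spheres I*, Ann. of Math. (2) 77 (1963) 504–537: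
  table p. 504, Lemma 2.3 (p. 506), Thm. 3.1 (p. 508), §4 (Lemma 4.2 p. 510, table p. 512),
  Thm. 5.1 (p. 512). doi:10.2307/1970128 [KervaireMilnorAnnals1963]
-/

noncomputable section

open scoped Manifold ContDiff
open Set Literature.Topology.FourManifolds Literature.AlgebraicTopology.SingularHomology

namespace Literature.Barriers.SmoothPoincare4

universe u

/-- **`StableBarrierFour` GIVEN the bounding form of `Θ₄ = 0`.** If every homotopy `4`-sphere
bounds a contractible compact smooth `5`-manifold (`BoundsContractible 4 Σ`; the conclusion of
`HomotopySphere.boundsContractible_four_of`, i.e. `bP₅ ⊇ Θ₄` collapsed with Thm. 5.1), then no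
`S² × S²`-stable invariant distinguishes a homotopy `4`-sphere from `S⁴`: Kervaire–Milnor's
Lemma 2.3, `⇐` (a simply connected closed manifold bounding a contractible manifold is h-cobordant
to the sphere) is the tree theorem `isHCobordant_sphere_of_boundsContractible_holds`
(`HomotopySpheresInverseDischarge.lean`), giving `Θ₄ = 0` in the h-cobordism form
(`isHCobordant_sphere_of_homotopySphere_four_of`), and then `stableBarrierFour_of_thetaFour`.
[cite: KervaireMilnorAnnals1963, Lemma 2.3 (p. 506) and table p. 504] [cite: WallJLMS1964, Thm. 3] [cite: Reutter2023SemisimpleTFT, §1.1 Thm. 1 and Cor. 2] -/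
theorem stableBarrierFour_of_forall_boundsContractible
    (hΘ : ∀ S : HomotopySphere 4, BoundsContractible 4 S.carrier) :
    StableBarrierFour.{u} :=
  stableBarrierFour_of_thetaFour
    (isHCobordant_sphere_of_homotopySphere_four_of isHCobordant_sphere_of_boundsContractible_holds hΘ)

/-- **`StableBarrierFour` from Wall's Thm. 2 ALONE.** GIVEN Wall 1964, Thm. 2 ("Two
simply-connected closed 4-manifolds with isomorphic quadratic forms are h-cobordant"; the named
fact `isHCobordant_of_equivalent_intersectionForm`), every homotopy `4`-sphere is h-cobordant to
`S⁴` (`isHCobordant_sphere_of_homotopySphere_four_of_wallThmTwo`, `ThetaFourWall.lean`: both forms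
vanish), and the barrier follows by `stableBarrierFour_of_thetaFour` — Wall's Thm. 3, required as
a second hypothesis by `stableBarrierFour_of_wallThmTwo_thmThree` (`StableInvariantsBlindProofs.lean`),
is now proved for the even ends that occur. REMAINING HYPOTHESES: 1.
[cite: WallJLMS1964, Thm. 2 (p. 141) and Thm. 3] [cite: Reutter2023SemisimpleTFT, §1.1 Thm. 1 and Cor. 2] -/
theorem stableBarrierFour_of_wallThmTwo (hW₂ : isHCobordant_of_equivalent_intersectionForm) :
    StableBarrierFour.{u} :=
  stableBarrierFour_of_thetaFour (isHCobordant_sphere_of_homotopySphere_four_of_wallThmTwo hW₂)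

/-- **`StableBarrierFour` over the four remaining leaves of Kervaire–Milnor's proof of
`Θ₄ = 0`.** GIVEN (3.1, in dimension `4`) every homotopy `4`-sphere is s-parallelizable,
(Lemma 4.2, `⇒`) a normally framed closed manifold whose Pontryagin–Thom collapse is null-homotopic
bounds a parallelizable manifold (`boundsParallelizable_of_collapseNullHomotopic`), (`Π₄ = 0`)
`piStable_four_trivial`, and (Thm. 5.1 at `k = 2`) a homotopy `4`-sphere bounding an
s-parallelizable manifold bounds a contractible one
(`HomotopySphere.boundsContractible_of_nullCobordism_isStablyParallelizable_four`), the barrier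
holds: `isHCobordant_sphere_of_homotopySphere_four_of_frontier₄`
(`ThetaFourKervaireMilnorProofs.lean`; Lemma 2.3 and the normally framed embedding (a) being tree
theorems) gives `Θ₄ = 0`, then `stableBarrierFour_of_thetaFour`. Compared with
`stableBarrierFour_of_collapseLeaves₅` (`StableInvariantsBlindProofs.lean`), Kirby's middle-level
statement K1′ is no longer a hypothesis and Thm. 3.1 is needed in dimension `4` only.
REMAINING HYPOTHESES: 4.
[cite: KervaireMilnorAnnals1963, table p. 504 (Θ₄ = 0) via Lemma 2.3, Thm. 3.1, §4 (Lemma 4.2 p. 510, table p. 512) and Thm. 5.1 (p. 512)] [cite: WallJLMS1964, Thm. 3] [cite: Reutter2023SemisimpleTFT, §1.1 Thm. 1 and Cor. 2] -/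
theorem stableBarrierFour_of_kervaireMilnorFrontier
    (h31 : ∀ S : HomotopySphere 4, IsStablyParallelizable (𝓡 4) S.carrier)
    (hb : boundsParallelizable_of_collapseNullHomotopic) (hPi : piStable_four_trivial)
    (h51 : HomotopySphere.boundsContractible_of_nullCobordism_isStablyParallelizable_four) :
    StableBarrierFour.{u} :=
  stableBarrierFour_of_thetaFour
    (isHCobordant_sphere_of_homotopySphere_four_of_frontier₄ h31 hb hPi h51)

end Literature.Barriers.SmoothPoincare4

end
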